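import Summits.MatrixMultiplication.MatrixMultiplication.Theorems.SaturationLadderUniformDefect
import HarnessLib

/-!
# Saturation ladder — Kernel XXV-C: continuity of the frontier defect and the worst-shape dichotomy

Cell `decomp-mm`, lens `decomp-mm-lens-1` (grading / quantitative ladder), gen 53; supports the
deciding crux `SubexpSaturation` (item 25909) of `route-MatrixMultiplication-SaturationLadder`.
No new hypotheses, no `sorry`.

The frontier `τ_ℂ(r) = sup {t | ω(1,t,r) ≤ 1+r}` is concave on `[0,∞)` (Kernel XXIV
`frontier_concaveOn`, Lotti–Romani convexity), hence CONTINUOUS on `(0,∞)`, and so is the defect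
`Δ(r) = (1 − τ_ℂ(r))·log r` (§1).  Consequence (§2, compactness of bounded windows):

  **DICHOTOMY.**  Either `Δ` attains its supremum over `[1,∞)` at some finite length `r⋆ ≥ 1`
  (`∀ r ≥ 1, Δ(r) ≤ Δ(r⋆)`), or every value `Δ(r₀)` is exceeded at arbitrarily large lengths
  (`∀ r₀ ≥ 1, ∃ᶠ r → ∞, Δ(r) > Δ(r₀)`, in particular `limsup Δ ≥ sup Δ`)  (`frontierDefect_dichotomy`).

Read against the two feet of the ladders (Kernel XXIV: `¬(ω = 2) ⟺ ∃ r > 1, Δ(r) > 0`;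
`¬SubexpSaturation ⟺ ∃ κ > 0, Δ > κ frequently`):

* under piece 1 (`SubexpSaturation`, `Δ → 0`) the supremum of the defect IS ATTAINED
  (`frontierDefect_max_attained_of_subexp`);
* `¬(ω = 2) ⟹` a WORST FINITE SHAPE `r⋆ > 1` with `0 < Δ(r⋆) = max Δ`, or `¬SubexpSaturation`
  (`worstShape_or_not_subexp`); so **`SubexpSaturation ∧ ¬(ω = 2) ⟹ ∃ r⋆ > 1` maximising the
  defect with `Δ(r⋆) > 0`** (`exists_worstShape`), and the residual chain `h₂ ∘ … ∘ h₅` of the route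
  (`SubexpSaturation → ω = 2`) is EQUIVALENT to "under piece 1 no finite shape has a positive maximal
  defect" (`residual_iff_noWorstShape`) — the uniform ladder `U(C) ⟺ Δ ≤ C` of Kernel XXIV then
  reads: `inf {C | U(C)} = Δ(r⋆)` is a value of the defect at ONE rectangular shape `⟨1, τ(r⋆), r⋆⟩`.

[novel: the dichotomy and the worst-shape reading of the residual are this lineage's; continuity is
Mathlib's `ConcaveOn.continuousOn_interior` applied to Kernel XXIV's concavity (Lotti–Romani 1983).]
-/


set_option linter.dupNamespace false

namespace Summit.MatrixMultiplication.MatrixMultiplication.Theorems.SaturationLadderWorstShape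

open Literature.Computability.AlgebraicComplexity
open Summit.MatrixMultiplication.MatrixMultiplication.Theses.SaturationLadder
open Summit.MatrixMultiplication.MatrixMultiplication.Theorems.SaturationLadderFrontierDefect
open Summit.MatrixMultiplication.MatrixMultiplication.Theorems.SaturationLadderUniformDefect
open Filter Topology

noncomputable section

/-! ## §1 Continuity -/

/-- **The frontier `τ_ℂ` is continuous on `(0, ∞)`** (a concave function is continuous on the
interior of its domain). [cite: LottiRomani1983, §1 (p. 173)] -/
theorem frontier_continuousOn :
    ContinuousOn (fun r : ℝ => sSup {t : ℝ | omegaRect ℂ 1 t r ≤ 1 + r}) (Set.Ioi 0) := by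
  have h := frontier_concaveOn.continuousOn_interior
  rwa [interior_Ici] at h

/-- **The defect `Δ(r) = (1 − τ_ℂ(r))·log r` is continuous on `(0, ∞)`.** [folklore] -/
theorem frontierDefect_continuousOn :
    ContinuousOn (fun r : ℝ => (1 - sSup {t : ℝ | omegaRect ℂ 1 t r ≤ 1 + r}) * Real.log r)
      (Set.Ioi 0) :=
  (continuousOn_const.sub frontier_continuousOn).mul
    (Real.continuousOn_log.mono fun _ hr => ne_of_gt hr)

/-! ## §2 The dichotomy -/

/-- **DICHOTOMY for the frontier defect on `[1, ∞)`**: either its supremum is attained at a finite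
length, or every value is exceeded at arbitrarily large lengths.  (If some value `Δ(r₀)` is
eventually not exceeded, say on `[R, ∞)`, the maximum of the continuous `Δ` on the compact window
`[1, max(R, r₀)]` is a global maximum.) [folklore] -/
theorem frontierDefect_dichotomy :
    (∃ r₀ : ℝ, 1 ≤ r₀ ∧ ∀ r : ℝ, 1 ≤ r →
        (1 - sSup {t : ℝ | omegaRect ℂ 1 t r ≤ 1 + r}) * Real.log r ≤
          (1 - sSup {t : ℝ | omegaRect ℂ 1 t r₀ ≤ 1 + r₀}) * Real.log r₀) ∨
    (∀ r₀ : ℝ, 1 ≤ r₀ → ∃ᶠ r in atTop,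
        (1 - sSup {t : ℝ | omegaRect ℂ 1 t r₀ ≤ 1 + r₀}) * Real.log r₀ <
          (1 - sSup {t : ℝ | omegaRect ℂ 1 t r ≤ 1 + r}) * Real.log r) := by
  set Δ : ℝ → ℝ := fun r => (1 - sSup {t : ℝ | omegaRect ℂ 1 t r ≤ 1 + r}) * Real.log r with hΔ
  show (∃ r₀ : ℝ, 1 ≤ r₀ ∧ ∀ r : ℝ, 1 ≤ r → Δ r ≤ Δ r₀) ∨
    (∀ r₀ : ℝ, 1 ≤ r₀ → ∃ᶠ r in atTop, Δ r₀ < Δ r)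
  rcases Classical.em (∀ r₀ : ℝ, 1 ≤ r₀ → ∃ᶠ r in atTop, Δ r₀ < Δ r) with hB | hB
  · exact Or.inr hB
  · left
    obtain ⟨r₀, hr₀'⟩ := not_forall.1 hB
    obtain ⟨hr₀, hnot⟩ := Classical.not_imp.1 hr₀'
    rw [Filter.not_frequently, Filter.eventually_atTop] at hnot
    obtain ⟨R, hR⟩ := hnot
    have hcont : ContinuousOn Δ (Set.Icc 1 (max R r₀)) :=
      frontierDefect_continuousOn.mono fun r hr => lt_of_lt_of_le one_pos hr.1
    have hne : (Set.Icc 1 (max R r₀)).Nonempty := ⟨r₀, hr₀, le_max_right _ _⟩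
    obtain ⟨rs, hrs, hmax⟩ := isCompact_Icc.exists_isMaxOn hne hcont
    refine ⟨rs, hrs.1, fun r hr => ?_⟩
    rcases le_or_gt r (max R r₀) with hle | hgt
    · exact hmax ⟨hr, hle⟩
    · have h1 : ¬ Δ r₀ < Δ r := hR r ((le_max_left _ _).trans hgt.le)
      have h2 : Δ r₀ ≤ Δ rs := hmax ⟨hr₀, le_max_right _ _⟩
      exact (not_lt.1 h1).trans h2

/-- **Under piece 1 the supremum of the defect is attained.**  If `SubexpSaturation` (`Δ → 0`),
then some `r⋆ ≥ 1` has `Δ(r) ≤ Δ(r⋆)` for all `r ≥ 1`. [folklore] -/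
theorem frontierDefect_max_attained_of_subexp (h₁ : SubexpSaturation) :
    ∃ r₀ : ℝ, 1 ≤ r₀ ∧ ∀ r : ℝ, 1 ≤ r →
      (1 - sSup {t : ℝ | omegaRect ℂ 1 t r ≤ 1 + r}) * Real.log r ≤
        (1 - sSup {t : ℝ | omegaRect ℂ 1 t r₀ ≤ 1 + r₀}) * Real.log r₀ := by
  rcases frontierDefect_dichotomy with hA | hB
  · exact hA
  · exfalso
    have key : ∀ r₁ : ℝ, 1 ≤ r₁ →
        (1 - sSup {t : ℝ | omegaRect ℂ 1 t r₁ ≤ 1 + r₁}) * Real.log r₁ ≤ 0 := by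
      intro r₁ hr₁
      by_contra hpos
      exact (not_subexpSaturation_iff.2 ⟨_, lt_of_not_ge hpos, hB r₁ hr₁⟩) h₁
    obtain ⟨r, hlt, hr1⟩ := ((hB 1 le_rfl).and_eventually (eventually_ge_atTop 1)).exists
    rw [Real.log_one, mul_zero] at hlt
    linarith [key r hr1]

/-- **Worst shape or no piece 1.**  If `ω > 2` then either some finite length `r⋆ > 1` MAXIMISES the
defect over `[1,∞)` with `Δ(r⋆) > 0`, or `SubexpSaturation` fails. [folklore] -/
theorem worstShape_or_not_subexp (hS : ¬ _root_.MatrixMultiplication) :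
    (∃ r₀ : ℝ, 1 < r₀ ∧ 0 < (1 - sSup {t : ℝ | omegaRect ℂ 1 t r₀ ≤ 1 + r₀}) * Real.log r₀ ∧
        ∀ r : ℝ, 1 ≤ r → (1 - sSup {t : ℝ | omegaRect ℂ 1 t r ≤ 1 + r}) * Real.log r ≤
          (1 - sSup {t : ℝ | omegaRect ℂ 1 t r₀ ≤ 1 + r₀}) * Real.log r₀) ∨
    ¬ SubexpSaturation := by
  obtain ⟨r₁, hr₁, hpos⟩ := not_matrixMultiplication_iff.1 hS
  rcases frontierDefect_dichotomy with ⟨r₀, hr₀, hmax⟩ | hB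
  · left
    have hΔ₀ : 0 < (1 - sSup {t : ℝ | omegaRect ℂ 1 t r₀ ≤ 1 + r₀}) * Real.log r₀ :=
      hpos.trans_le (hmax r₁ hr₁.le)
    have hr₀1 : 1 < r₀ := by
      rcases eq_or_lt_of_le hr₀ with e | hlt
      · exfalso
        rw [← e, Real.log_one, mul_zero] at hΔ₀
        exact lt_irrefl _ hΔ₀
      · exact hlt
    exact ⟨r₀, hr₀1, hΔ₀, hmax⟩
  · right
    rw [not_subexpSaturation_iff]
    exact ⟨_, hpos, hB r₁ hr₁.le⟩

/-- **`SubexpSaturation ∧ ω > 2 ⟹` a worst finite shape**: some `r⋆ > 1` maximises the defect over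
`[1,∞)` and `Δ(r⋆) > 0` — the whole gap to `ω = 2` would then be carried by ONE rectangular shape
`⟨1, τ_ℂ(r⋆), r⋆⟩` (and `inf {C | U(C)} = Δ(r⋆)`, Kernel XXIV). [folklore] -/
theorem exists_worstShape (h₁ : SubexpSaturation) (hS : ¬ _root_.MatrixMultiplication) :
    ∃ r₀ : ℝ, 1 < r₀ ∧ 0 < (1 - sSup {t : ℝ | omegaRect ℂ 1 t r₀ ≤ 1 + r₀}) * Real.log r₀ ∧
      ∀ r : ℝ, 1 ≤ r → (1 - sSup {t : ℝ | omegaRect ℂ 1 t r ≤ 1 + r}) * Real.log r ≤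
        (1 - sSup {t : ℝ | omegaRect ℂ 1 t r₀ ≤ 1 + r₀}) * Real.log r₀ :=
  (worstShape_or_not_subexp hS).resolve_right (not_not.2 h₁)

/-- **The residual chain, read on shapes.**  `SubexpSaturation → ω = 2` (the composite of the
route's pieces `h₂, …, h₅`) holds iff, under piece 1, NO finite length has a positive maximal
defect. [folklore] -/
theorem residual_iff_noWorstShape :
    (SubexpSaturation → _root_.MatrixMultiplication) ↔
    (SubexpSaturation → ¬ ∃ r₀ : ℝ, 1 < r₀ ∧
        0 < (1 - sSup {t : ℝ | omegaRect ℂ 1 t r₀ ≤ 1 + r₀}) * Real.log r₀ ∧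
        ∀ r : ℝ, 1 ≤ r → (1 - sSup {t : ℝ | omegaRect ℂ 1 t r ≤ 1 + r}) * Real.log r ≤
          (1 - sSup {t : ℝ | omegaRect ℂ 1 t r₀ ≤ 1 + r₀}) * Real.log r₀) := by
  constructor
  · rintro h h₁ ⟨r₀, hr₀, hΔ, -⟩
    have := frontierDefect_eq_zero_of_matrixMultiplication (h h₁) hr₀.le
    linarith
  · intro h h₁
    by_contra hS
    exact h h₁ (exists_worstShape h₁ hS)

/-- **Under piece 1, `ω = 2 ⟺` every finite shape that maximises the defect has defect `0`**
(equivalently: the attained maximum of `Δ` is `0`). [folklore] -/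
theorem matrixMultiplication_iff_maxDefect_zero (h₁ : SubexpSaturation) :
    _root_.MatrixMultiplication ↔
      ∀ r₀ : ℝ, 1 ≤ r₀ →
        (∀ r : ℝ, 1 ≤ r → (1 - sSup {t : ℝ | omegaRect ℂ 1 t r ≤ 1 + r}) * Real.log r ≤
          (1 - sSup {t : ℝ | omegaRect ℂ 1 t r₀ ≤ 1 + r₀}) * Real.log r₀) →
        (1 - sSup {t : ℝ | omegaRect ℂ 1 t r₀ ≤ 1 + r₀}) * Real.log r₀ = 0 := by
  constructor
  · intro hS r₀ hr₀ _
    exact frontierDefect_eq_zero_of_matrixMultiplication hS hr₀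
  · intro h
    by_contra hS
    obtain ⟨r₀, hr₀, hΔ, hmax⟩ := exists_worstShape h₁ hS
    have := h r₀ hr₀.le hmax
    linarith

end

end Summit.MatrixMultiplication.MatrixMultiplication.Theorems.SaturationLadderWorstShape
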